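import Summits.HodgeConjecture.HodgeConjecture.Theorems.K2E3KazhdanL2OrthonormalCrossExtSplit   -- FILE A (this seat, p855016): `crossExtension_splits_of_isSquareIntegrable` (the `hsplit₂` letter at `L²` pairs); brings ★ (S5) `hsplit_of_isSquareIntegrable`
import Summits.HodgeConjecture.HodgeConjecture.Theorems.F0P3cStCharTSEPNormOneOfHsplit         -- ★ 73 §NW `innerG_char_self_eq_one_of_hsplit_of_not_wild` (EP-norm-one for ANY irreducible whose smooth self-extensions split, NOT-WILD `v`)
import Summits.HodgeConjecture.HodgeConjecture.Theorems.F0P3cStCharTSEPCrossNormZeroNotWild    -- ★ (X0′-NW) `innerG_char_cross_eq_zero_of_not_wild` (EP-cross-zero from `hsplit₂` + `hHom0`, NOT-WILD `v`)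
import Literature.NumberTheory.Automorphic.IrrClassSchurHomZero                                  -- ★ HOM-ZERO `SmoothIrrep.subsingleton_intertwiningMap_of_mk_ne_mk`
import Summits.HodgeConjecture.HodgeConjecture.Theorems.F0P3cStCharTSWeylDatumPinsWIF           -- ★ WIF-AT-THE-DATUM by pins: `weylIntegrationFormula_of_datumPins`
import Summits.HodgeConjecture.HodgeConjecture.Theorems.F0P3cStCharTSJacCartanTerminus          -- ★ JAC-ELL C8 terminus: `tubeJacobianSocket_compactCartan`
import Summits.HodgeConjecture.HodgeConjecture.Theorems.F0P3cStCharTSCartanReps                 -- ★ `exists_isRegularElt_centralizer_eq_cmTorus` (`M = Z(m₀)`)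
import Summits.HodgeConjecture.HodgeConjecture.Theorems.F0P3cStCharTSCartanFields               -- ★ (C2) `ellCartanAE_of_compact_centralizers`, (C3) `nonEllCartanAE_of_split`
import Summits.HodgeConjecture.HodgeConjecture.Theorems.F0P3cStCharTSCartanNull                 -- ★ `cartanNull_of_rootKernels`
import Summits.HodgeConjecture.HodgeConjecture.Theorems.F0P3cStCharTSDGField                    -- ★ `measurable_DG`, `DG_eq_zero_or_le` (from the closed formula `eDG`)
import Summits.HodgeConjecture.HodgeConjecture.Theorems.F0P3cStCharTSL2dOfHcb                   -- ★ `l2CharOnTorusAll_of_hcBounded` ((L2D∀) from `normalizedCharacter_locallyBounded`)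
import HarnessLib

/-!
# K2-LIT E3 · row #15 `K2E3KazhdanL2Orthonormal` · FILE B «NOT-WILD»: `⟨χ_π, χ_{π′}⟩_e = δ_{π,π′}` for ALL square-integrable `π`, `π′` of `U(Φ₃)(L⁺_v)` at every
# NOT-WILD non-split place (`v` unramified in `L` or `|2|_v = 1`) — [K] Theorem K ∕ Prop. 12.6.1 (a)(b) on `L²` pairs, IN HOUSE by the EXT road

Cell `pub/hodgecm-mathlib` (D-0151), Track B «K2-LIT» engine E3, socket item `stmt-HodgeConjecture-24833` (h413; lane `--supports … --as helper`);
seat `hodgecm-mathlib-K2E3-p15` (g0), SIGS-TABLE row #15 `sig_K2E3KazhdanL2Orthonormal` (`Cruxes/H413/Lines/K2_E3_EllipticInputsSigs_U5Kazhdan.lean` :47–147;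
conclusion `∀ π π′, 𝔇.IsL2 π → 𝔇.IsL2 π′ → 𝔇.innerG (𝔇.char π) (𝔇.char π′) = if π = π′ then 1 else 0`).  THEOREMS ONLY (no definition ∕ instance ∕ notation ∕
named fact ∕ `sorry`); ★-only imports.  Namespace `Summit.HodgeConjecture.HodgeConjecture.Cruxes.H413.K2E3KazhdanL2OrthonormalNotWild`.

THE MATHEMATICS ([Rogawski1990 §12.6 Prop. 12.6.1 (a) p. 188 «If `π` is square-integrable, then `⟨χ_π, χ_π⟩_e = 1`», (b); [Kazhdan1986 Thm K];
[SchneiderStuhler1997 §III.4]: `Tr π′(f_EP^π) = EP(π, π′) = Σ (−1)^i dim Extⁱ_G(π, π′)`).  At a NOT-WILD non-split `v` the cell's Euler–Poincaré road gives, for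
irreducible smooth `r`, `r′` of `G = U(Φ₃)(L⁺_v)` and a §12.5 datum `𝔇` carrying ★ PCT-OUT's letters (`Tr σ(f) = ⟨χ_σ, χ_π⟩_e` for a pseudo-coefficient `f` of `π`):
* NORM (`π = π′ = ⟦r⟧`): ★ 73 `innerG_char_self_eq_one_of_hsplit_of_not_wild` — `⟨χ_⟦r⟧, χ_⟦r⟧⟩_e = 1` as soon as every smooth self-extension of `r` splits, which ★ (S5)
  `hsplit_of_isSquareIntegrable` supplies at an `L²` class (Casselman's criterion + the unitarity trick);
* CROSS (`⟦r⟧ ≠ ⟦r′⟧`): ★ (X0′-NW) `innerG_char_cross_eq_zero_of_not_wild` — `⟨χ_⟦r⟧, χ_⟦r′⟧⟩_e = 0` from `Hom_G(r′, r) = 0` (Schur, ★ HOM-ZERO) and the splitting of every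
  smooth extension of `r′` by `r` — FILE A `crossExtension_splits_of_isSquareIntegrable` (both classes `L²`).
NO supercuspidal ∕ Steinberg ∕ `π²(ξ)` case split, NO Keys list, NO character value.
* §1 **`innerG_char_eq_ite_of_isL2_of_not_wild`** — the conclusion of row #15 at a NOT-WILD place, in the junction letters of ★ 73 ∕ (X0′-NW)
  (`hns hv νQv mQv hcanQ 𝔇 hμG horb hreg hE hM1` + the centre-quotient Haar `μZ`, `hμGZ : 𝔇.μGZ = μZ` + ★ PCT-OUT's `hWIF hC1 hC2 hC3 hL2`).
* §2 **`innerG_char_eq_ite_of_isL2_of_not_wild_of_pins`** — the same with ★ PCT-OUT's five letters DISCHARGED from the socket's own Cartan∕`D_G` pins exactly as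
  ★ «DATUM-JUNCTION v15» does (`hWIF` ⟸ ★ `weylIntegrationFormula_of_datumPins` over `hAll hcart hcovA hncA hcptA hHaar hHaarG hinvT hcoreT eDG` + ★ JAC-ELL; `hC1` ⟸ `hAll`;
  `hC2` ⟸ ★ `ellCartanAE_of_compact_centralizers` + ★ `cartanNull_of_rootKernels` over `hE hcart hHaarG hker`; `hC3` ⟸ ★ `nonEllCartanAE_of_split` over `hC05 hE hAll hHaar`;
  `hL2` ⟸ ★ `l2CharOnTorusAll_of_hcBounded` over `hchar hcart hfinG eDG` AND Harish-Chandra's local boundedness `normalizedCharacter_locallyBounded` — the ONE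
  letter `hHCB` that is NOT among the socket's 54 pins: it is tier-0 stub 2 `stub_charLocBdd` of the SAME line, paid by rows #12∕#14).
HONEST LABEL: count-neutral helper (`--supports`); row #15 stays OPEN: its socket is UNGATED and at a WILD place (`v ∣ 2` ramified in `L`) no EP head exists in the
tree (row #21 ∕ Track A «FOUR-FRAME») — there [K] Thm K is print of record; FILE C reduces the socket BY NAME to `hHCB` + that wild residual.  HC_CM is proved
only modulo the 7 printed citations (2 remaining named inputs hLiu418 = `stmt-HodgeConjecture-24832`, h413 = `stmt-HodgeConjecture-24833`) until rung 0 closes;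
nothing printed is asserted here.

## References
* [Rogawski1990] J. D. Rogawski, *Automorphic Representations of Unitary Groups in Three Variables*, Ann. of Math. Stud. 123 (1990): §12.5 pp. 182–187
  (Weyl integration formula, `⟨ , ⟩_e`), §12.6 p. 187 (`Tr π′(f_π) = ⟨χ_{π′}, χ_π⟩_e`), Prop. 12.6.1 (a)(b) p. 188.
* [Kazhdan1986CuspidalGeometry] D. Kazhdan, *Cuspidal geometry of p-adic groups*, J. Analyse Math. 47 (1986) 1–36: Theorem K (audit: WANT acq-15177).
* [SchneiderStuhler1997] P. Schneider, U. Stuhler, Publ. Math. IHÉS 85 (1997): §III.4 (Euler–Poincaré functions and `EP(π, π′)`).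
* [Casselman1995] W. Casselman, *Introduction to the theory of admissible representations of `p`-adic reductive groups* (1995): §2.5, Thm. 4.4.6.
* [HarishChandra1999] Harish-Chandra (eds. DeBacker–Sally), *Admissible invariant distributions on reductive p-adic groups*, AMS ULS 16 (1999): Thm. 16.3
  (local boundedness of `|D|^{1∕2} Θ_π` — the letter `hHCB`).
-/

set_option autoImplicit false
-- the mandated namespace has the single-problem summit's repeated segment (`HodgeConjecture.HodgeConjecture`)
set_option linter.dupNamespace false

noncomputable section

open NumberField IsDedekindDomain MeasureTheory Filter Topology
open scoped Matrix MatrixGroups NNReal ENNReal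
open Literature.NumberTheory.Rogawski1990 Literature.NumberTheory.Rogawski1990.Ch12Sec5
open Literature.NumberTheory.Automorphic Literature.NumberTheory.Automorphic.UnitaryGroup
open Literature.NumberTheory.GaloisRepresentations

namespace Summit.HodgeConjecture.HodgeConjecture.Cruxes.H413.K2E3KazhdanL2OrthonormalNotWild

open Summit.HodgeConjecture.HodgeConjecture.Cruxes.H413 Summit.HodgeConjecture.HodgeConjecture.Cruxes.H413.F0P3cStCharTSTorusDefs

variable (L : Type) [Field L] [NumberField L] [IsCMField L] (v : HeightOneSpectrum (𝓞 ↥(maximalRealSubfield L)))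

/-! ## §1 `⟨χ_π, χ_{π′}⟩_e = δ_{π,π′}` for `L²` pairs at a NOT-WILD place — junction letters (★ 73 ∕ (X0′-NW) + the centre-quotient Haar measure) -/

set_option maxHeartbeats 1600000 in
set_option synthInstance.maxHeartbeats 400000 in
-- instance-term unification on the CM local carriers (class of ★ 73 ∕ ★ (X0′-NW)); `if` read classically, as in the socket
open scoped Classical in
/-- **[K] THEOREM K ∕ PROP. 12.6.1 (a)(b) ON `L²` PAIRS AT A NOT-WILD PLACE, junction letters.**  At a non-split place `v` that is NOT WILD
(`hv : v unramified in L ∨ |2|_v = 1`), at a §12.5 datum `𝔇` on `G = U(Φ₃)(L⁺_v)` with the junction pins `hμG horb hreg hE hM1`, the centre-quotient Haar measure `μZ`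
(`hμGZ : 𝔇.μGZ = μZ`, the currency of `𝔇.IsL2`) and ★ PCT-OUT's letters `hWIF hC1 hC2 hC3 hL2`: for all classes `π`, `π′` square-integrable modulo the centre,
**`⟨χ_π, χ_{π′}⟩_e = 1` if `π = π′` and `= 0` otherwise.**  NORM: ★ 73 `innerG_char_self_eq_one_of_hsplit_of_not_wild` fed by ★ (S5) `hsplit_of_isSquareIntegrable`;
CROSS: ★ (X0′-NW) `innerG_char_cross_eq_zero_of_not_wild` at (`r′`, `r`) fed by FILE A `crossExtension_splits_of_isSquareIntegrable` and ★ HOM-ZERO.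
[cite: Rogawski1990, §12.6 Prop. 12.6.1 (a) p. 188] [cite: Kazhdan1986CuspidalGeometry, Thm. K] [cite: SchneiderStuhler1997, §III.4] [cite: Casselman1995, Thm. 4.4.6] -/
theorem innerG_char_eq_ite_of_isL2_of_not_wild
    (hns : ∀ w : PlacesOver L v, IsCMField.complexConj L • w.1 = w.1) (hv : Algebra.IsUnramifiedIn (𝓞 L) v.asIdeal ∨ Valued.v (2 : v.adicCompletion ↥(maximalRealSubfield L)) = 1)
    [MeasurableSpace (Gqs L v)] [BorelSpace (Gqs L v)]
    [∀ γ : Gqs L v, MeasurableSpace (Gqs L v ⧸ Subgroup.centralizer ({γ} : Set (Gqs L v)))] [∀ γ : Gqs L v, BorelSpace (Gqs L v ⧸ Subgroup.centralizer ({γ} : Set (Gqs L v)))]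
    [MeasurableSpace (Gqs L v ⧸ Subgroup.center (Gqs L v))] [BorelSpace (Gqs L v ⧸ Subgroup.center (Gqs L v))]
    {H : Type} [Group H] [TopologicalSpace H] [IsTopologicalGroup H] [MeasurableSpace H]
    (νQv : Measure (Gqs L v)) [νQv.IsHaarMeasure] [νQv.IsMulRightInvariant] (mQv : OrbitalMeasureFamily (Gqs L v))
    (hcanQ : mQv.IsCanonical (fun γ => IsRegularElt (γ.val : GL (Fin 3) (UnitaryGroup.LocalRing L v))) νQv)
    (𝔇 : EllipticData (Gqs L v) H) (hμG : 𝔇.μG = νQv) (horb : 𝔇.orb = mQv)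
    (hreg : ∀ γ : Gqs L v, γ ∈ 𝔇.regG ↔ IsRegularElt (γ.val : GL (Fin 3) (UnitaryGroup.LocalRing L v)))
    (hE : ∀ γ : Gqs L v, γ ∈ 𝔇.ellG ↔ IsRegularElt (γ.val : GL (Fin 3) (UnitaryGroup.LocalRing L v)) ∧ γ ∉ hyperbolicSet L v)
    (hM1 : ∀ π : IrrClass (Gqs L v), Measurable (𝔇.char π) ∧ LocallyIntegrable (𝔇.char π) 𝔇.μG ∧ (∀ x ∈ 𝔇.regG, ∀ᶠ y in 𝓝 x, 𝔇.char π y = 𝔇.char π x) ∧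
      ∀ φ : Gqs L v → ℂ, IsLocSmooth φ → π.smoothTrace 𝔇.μG φ = ∫ x, φ x * 𝔇.char π x ∂𝔇.μG)
    (μZ : Measure (Gqs L v ⧸ Subgroup.center (Gqs L v))) [μZ.IsHaarMeasure] (hμGZ : 𝔇.μGZ = μZ)
    (hWIF : 𝔇.WeylIntegrationFormula) (hC1 : 𝔇.EllCartanSubset) (hC2 : 𝔇.EllCartanAE) (hC3 : 𝔇.NonEllCartanAE) (hL2 : 𝔇.L2CharOnTorusAll)   -- ★ PCT-OUT's extra letters
    :
    ∀ π π' : IrrClass (Gqs L v), 𝔇.IsL2 π → 𝔇.IsL2 π' → 𝔇.innerG (𝔇.char π) (𝔇.char π') = if π = π' then 1 else 0 := by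
  intro π π' hπ hπ'
  obtain ⟨r, rfl⟩ := IrrClass.mk_surjective π
  obtain ⟨r', rfl⟩ := IrrClass.mk_surjective π'
  -- the two classes are square-integrable for the Haar measure `μZ` on `G ⧸ Z(G)` (`𝔇.IsL2` along `hμGZ`)
  have hL2r : (IrrClass.mk r).IsSquareIntegrable μZ := by
    have h : IrrClass.IsSquareIntegrable 𝔇.μGZ (IrrClass.mk r) := hπ
    rwa [hμGZ] at h
  have hL2r' : (IrrClass.mk r').IsSquareIntegrable μZ := by
    have h : IrrClass.IsSquareIntegrable 𝔇.μGZ (IrrClass.mk r') := hπ'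
    rwa [hμGZ] at h
  by_cases hrr : IrrClass.mk r = IrrClass.mk r'
  · -- NORM: ★ 73 at `r`, its `hsplit` by ★ (S5)
    rw [if_pos hrr, ← hrr]
    exact F0P3cStCharTSEPNormOneOfHsplit.innerG_char_self_eq_one_of_hsplit_of_not_wild L v hns hv νQv mQv hcanQ 𝔇 hμG horb hreg hE hM1
      hWIF hC1 hC2 hC3 hL2 r (F0P3cStCharTSHsplitOfL2.hsplit_of_isSquareIntegrable L v hns μZ r hL2r)
  · -- CROSS: ★ (X0′-NW) at (`r′`, `r`): extensions of `r′` by `r` split (FILE A), `Hom_G(r′, r) = 0` (★ HOM-ZERO)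
    rw [if_neg hrr]
    exact F0P3cStCharTSEPCrossNormZeroNotWild.innerG_char_cross_eq_zero_of_not_wild L v hns hv νQv mQv hcanQ 𝔇 hμG horb hreg hE hM1
      hWIF hC1 hC2 hC3 hL2 r' r
      (K2E3KazhdanL2OrthonormalCrossExtSplit.crossExtension_splits_of_isSquareIntegrable L v hns μZ r' r hL2r' hL2r)
      (SmoothIrrep.subsingleton_intertwiningMap_of_mk_ne_mk r' r (Ne.symm hrr))

/-! ## §0 ★ PCT-OUT's five letters from the socket's Cartan ∕ `D_G` pins and Harish-Chandra's boundedness (★ J15's recipe; NO place token) -/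

set_option maxHeartbeats 1600000 in
set_option synthInstance.maxHeartbeats 400000 in
-- instance-term unification on the CM local carriers (class of ★ J15)
/-- **★ PCT-OUT's LETTERS AT THE SOCKET'S DATUM** — the Weyl integration formula, (C1) `EllCartanSubset`, (C2) `EllCartanAE`, (C3) `NonEllCartanAE` and (L2D∀)
`L2CharOnTorusAll` — DERIVED from the socket's own pins exactly as ★ «DATUM-JUNCTION v15» does: `hWIF` ⟸ ★ `weylIntegrationFormula_of_datumPins` (the
`M`-representative `M = Z(m₀)` by ★ `exists_isRegularElt_centralizer_eq_cmTorus`, the compact-Cartan tube Jacobians by ★ `tubeJacobianSocket_compactCartan`) over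
`hAll hcart hcovA hncA hcptA hHaar hHaarG hinvT hcoreT eDG`; (C1) ⟸ `hAll`; (C2) ⟸ ★ `ellCartanAE_of_compact_centralizers` + ★ `cartanNull_of_rootKernels` over `hE hcart hHaarG hker`;
(C3) ⟸ ★ `nonEllCartanAE_of_split` over `hC05 hE hAll hHaar`; (L2D∀) ⟸ ★ `l2CharOnTorusAll_of_hcBounded` over `hchar hcart hfinG eDG` AND the named input
`hHCB : normalizedCharacter_locallyBounded` [HarishChandra1999 Thm. 16.3] — the ONE letter that is not among the socket's 54 pins (tier-0 stub 2 `stub_charLocBdd` of the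
same line).  Place-token free (every non-split `v`): it is what a WILD closer of row #15 also starts from.  Binder texts = the socket's pins VERBATIM.
[cite: Rogawski1990, §12.5 pp. 182–184] [cite: HarishChandra1970, Lemma 22; Lemma 42] [cite: HarishChandra1999, Thm. 16.3] -/
theorem pctOutLetters_of_pins
    (hns : ∀ w : PlacesOver L v, IsCMField.complexConj L • w.1 = w.1)
    [MeasurableSpace (Gqs L v)] [BorelSpace (Gqs L v)]
    [∀ γ : Gqs L v, MeasurableSpace (Gqs L v ⧸ Subgroup.centralizer ({γ} : Set (Gqs L v)))] [∀ γ : Gqs L v, BorelSpace (Gqs L v ⧸ Subgroup.centralizer ({γ} : Set (Gqs L v)))]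
    [MeasurableSpace (Gqs L v ⧸ Subgroup.center (Gqs L v))]
    {H : Type} [Group H] [TopologicalSpace H] [IsTopologicalGroup H] [MeasurableSpace H]
    (νQv : Measure (Gqs L v)) [νQv.IsHaarMeasure] [νQv.IsMulRightInvariant] (mQv : OrbitalMeasureFamily (Gqs L v))
    (hcanQ : mQv.IsCanonical (fun γ => IsRegularElt (γ.val : GL (Fin 3) (UnitaryGroup.LocalRing L v))) νQv)
    (𝔇 : EllipticData (Gqs L v) H)
    (hC01 : 𝔇.μG = νQv) (hC04 : 𝔇.orb = mQv)
    (hC05 : ∀ γ : Gqs L v, γ ∈ 𝔇.regG ↔ IsRegularElt (γ.val : GL (Fin 3) (UnitaryGroup.LocalRing L v)))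
    (hE : ∀ γ : Gqs L v, γ ∈ 𝔇.ellG ↔ IsRegularElt (γ.val : GL (Fin 3) (UnitaryGroup.LocalRing L v)) ∧ γ ∉ hyperbolicSet L v)
    (hchar : ∀ π : IrrClass (Gqs L v), Measurable (𝔇.char π) ∧ LocallyIntegrable (𝔇.char π) 𝔇.μG ∧
      (∀ x ∈ 𝔇.regG, ∀ᶠ y in 𝓝 x, 𝔇.char π y = 𝔇.char π x) ∧
      ∀ φ : Gqs L v → ℂ, IsLocSmooth φ → π.smoothTrace 𝔇.μG φ = ∫ x, φ x * 𝔇.char π x ∂𝔇.μG)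
    (hAll : ∀ T : Subgroup (Gqs L v), T ∈ 𝔇.cartanAll ↔ T = (cmBorelTriple L 3 v).M ∨ T ∈ 𝔇.cartanG)
    (hHaar : (𝔇.μT (cmBorelTriple L 3 v).M).IsHaarMeasure)
    (hcart : ∀ T ∈ 𝔇.cartanG, IsCompact (T : Set (Gqs L v)) ∧ ∃ γ₀ : Gqs L v, IsRegularElt (γ₀.val : GL (Fin 3) (UnitaryGroup.LocalRing L v)) ∧ T = Subgroup.centralizer ({γ₀} : Set (Gqs L v)))
    (hHaarG : ∀ T ∈ 𝔇.cartanG, (𝔇.μT T).IsHaarMeasure)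
    (hfinG : ∀ T ∈ 𝔇.cartanG, IsFiniteMeasure (𝔇.μT T))
    (hker : ∀ T ∈ 𝔇.cartanG, ∃ s : Finset (Subgroup ↥T), (∀ K ∈ s, IsClosed (K : Set ↥T) ∧ ¬ IsOpen (K : Set ↥T)) ∧ ∀ t : ↥T, ¬ IsRegularElt ((t : Gqs L v).val : GL (Fin 3) (UnitaryGroup.LocalRing L v)) → ∃ K ∈ s, t ∈ K)
    (eDG : ∀ g : Gqs L v, 𝔇.DG g = ((NNReal.sqrt (NNReal.sqrt ((∏ w : PlacesOver L v, IsNonarchimedeanLocalField.normAbs (w.1.adicCompletion L) (((g.val : GL (Fin 3) (UnitaryGroup.LocalRing L v)).val.charpoly.discr) w)) * ((∏ w : PlacesOver L v, IsNonarchimedeanLocalField.normAbs (w.1.adicCompletion L) (((g.val : GL (Fin 3) (UnitaryGroup.LocalRing L v)).val.det) w)) ^ 2)⁻¹)) : NNReal) : ℝ))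
    (hcovA : ∀ γ : Gqs L v, IsRegularElt (γ.val : GL (Fin 3) (UnitaryGroup.LocalRing L v)) → ∃ T' ∈ 𝔇.cartanAll, ∃ x : Gqs L v, ∀ g : Gqs L v, g ∈ Subgroup.centralizer ({γ} : Set (Gqs L v)) ↔ x⁻¹ * g * x ∈ T')
    (hncA : ∀ T' ∈ 𝔇.cartanAll, ∀ T'' ∈ 𝔇.cartanAll, T' ≠ T'' → ∀ y : Gqs L v, ¬ ∀ h : Gqs L v, h ∈ T'' ↔ y⁻¹ * h * y ∈ T')
    (hcptA : ∀ T' ∈ 𝔇.cartanAll, T' ≠ (cmBorelTriple L 3 v).M → IsCompact (T' : Set (Gqs L v)))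
    (hinvT : ∀ T' ∈ 𝔇.cartanAll, (𝔇.μT T').IsInvInvariant)
    (hcoreT : ∀ T' ∈ 𝔇.cartanAll, 𝔇.μT T' (compactCore ↥T') = 1)
    -- Harish-Chandra's local boundedness of `|D_G|^{1∕2} χ_π` — NOT a pin of the socket (tier-0 stub 2 `stub_charLocBdd`)
    (hHCB : normalizedCharacter_locallyBounded) :
    𝔇.WeylIntegrationFormula ∧ 𝔇.EllCartanSubset ∧ 𝔇.EllCartanAE ∧ 𝔇.NonEllCartanAE ∧ 𝔇.L2CharOnTorusAll := by
  -- ★ DG-FIELD: the `D_G` clauses from the closed formula `eDG`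
  have hDGm : Measurable 𝔇.DG := F0P3cStCharTSDGField.measurable_DG L v 𝔇 eDG
  have hDG := F0P3cStCharTSDGField.DG_eq_zero_or_le L v 𝔇 eDG
  -- ★ WIF-AT-THE-DATUM: the Weyl integration formula from the Cartan pins (the `M`-representative ★ CartanReps, compact-Cartan tube Jacobians ★ JAC-ELL)
  have hShapeA : ∀ T' ∈ 𝔇.cartanAll, ∃ γ₀ : Gqs L v, IsRegularElt (γ₀.val : GL (Fin 3) (UnitaryGroup.LocalRing L v)) ∧ T' = Subgroup.centralizer ({γ₀} : Set (Gqs L v)) :=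
    fun T' hT' => by
    rcases (hAll T').1 hT' with h | h
    · subst h; obtain ⟨m₀, -, hreg, hZ⟩ := F0P3cStCharTSCartanReps.exists_isRegularElt_centralizer_eq_cmTorus L v hns; exact ⟨m₀, hreg, hZ.symm⟩
    · exact (hcart T' h).2
  have hHaarT : ∀ T' ∈ 𝔇.cartanAll, (𝔇.μT T').IsHaarMeasure := fun T' hT' => by
    rcases (hAll T').1 hT' with h | h
    · subst h; exact hHaar
    · exact hHaarG T' h
  have hWIF : 𝔇.WeylIntegrationFormula :=
    F0P3cStCharTSWeylDatumPinsWIF.weylIntegrationFormula_of_datumPins L v hns νQv mQv 𝔇 hC01 hC04 hcanQ hC05 hShapeA hcovA hncA hcptA hHaarT hinvT hcoreT eDG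
      (F0P3cStCharTSJacCartanTerminus.tubeJacobianSocket_compactCartan L v hns νQv)
  -- (C1) (C2) (C3) exactly as ★ J15
  have hC2cert : 𝔇.EllCartanAE :=
    F0P3cStCharTSCartanFields.ellCartanAE_of_compact_centralizers L v 𝔇 hE hcart
      (F0P3cStCharTSCartanNull.cartanNull_of_rootKernels L v 𝔇 hHaarG (fun T hT => (hcart T hT).1) hker)
  have hC1cert : 𝔇.EllCartanSubset := fun T hT => (hAll T).2 (Or.inr hT)
  have hC3cert : 𝔇.NonEllCartanAE :=
    F0P3cStCharTSCartanFields.nonEllCartanAE_of_split L v 𝔇 hC05 hE (fun T hT hTn => ((hAll T).1 hT).resolve_right hTn) hHaar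
  -- (L2D∀) from Harish-Chandra's boundedness `hHCB`
  have hL2allcert : 𝔇.L2CharOnTorusAll :=
    F0P3cStCharTSL2dOfHcb.l2CharOnTorusAll_of_hcBounded L v hHCB νQv 𝔇 hC01 hC05 hchar hDGm (fun T hT => (hcart T hT).1) hfinG hDG
  exact ⟨hWIF, hC1cert, hC2cert, hC3cert, hL2allcert⟩

/-! ## §2 §1 in the socket's pins: ★ PCT-OUT's letters discharged by §0 -/

set_option maxHeartbeats 1600000 in
set_option synthInstance.maxHeartbeats 400000 in
-- instance-term unification on the CM local carriers (class of ★ J15); `if` read classically, as in the socket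
open scoped Classical in
/-- **[K] THEOREM K ON `L²` PAIRS AT A NOT-WILD PLACE, socket pins.**  §1 with ★ PCT-OUT's five letters DERIVED: the Weyl integration formula from the socket's Cartan pins
(★ `weylIntegrationFormula_of_datumPins`, the representative `M = Z(m₀)` by ★ `exists_isRegularElt_centralizer_eq_cmTorus`, the compact-Cartan tube Jacobians by ★
`tubeJacobianSocket_compactCartan`), (C1) from `hAll`, (C2) by ★ `ellCartanAE_of_compact_centralizers` + ★ `cartanNull_of_rootKernels`, (C3) by ★ `nonEllCartanAE_of_split`,
and (L2D∀) by ★ `l2CharOnTorusAll_of_hcBounded` from `D_G`'s closed formula (`eDG`) AND the named input `hHCB : normalizedCharacter_locallyBounded` [HarishChandra1999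
Thm. 16.3] — the only letter here that is not one of the socket's 54 pins (tier-0 stub 2 of the same line).  Binder texts = the socket's pins VERBATIM.
[cite: Rogawski1990, §12.6 Prop. 12.6.1 (a) p. 188; §12.5 p. 182] [cite: Kazhdan1986CuspidalGeometry, Thm. K] [cite: HarishChandra1999, Thm. 16.3] -/
theorem innerG_char_eq_ite_of_isL2_of_not_wild_of_pins
    (hns : ∀ w : PlacesOver L v, IsCMField.complexConj L • w.1 = w.1) (hv : Algebra.IsUnramifiedIn (𝓞 L) v.asIdeal ∨ Valued.v (2 : v.adicCompletion ↥(maximalRealSubfield L)) = 1)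
    [MeasurableSpace (Gqs L v)] [BorelSpace (Gqs L v)]
    [∀ γ : Gqs L v, MeasurableSpace (Gqs L v ⧸ Subgroup.centralizer ({γ} : Set (Gqs L v)))] [∀ γ : Gqs L v, BorelSpace (Gqs L v ⧸ Subgroup.centralizer ({γ} : Set (Gqs L v)))]
    [MeasurableSpace (Gqs L v ⧸ Subgroup.center (Gqs L v))] [BorelSpace (Gqs L v ⧸ Subgroup.center (Gqs L v))]
    {H : Type} [Group H] [TopologicalSpace H] [IsTopologicalGroup H] [MeasurableSpace H]
    (νQv : Measure (Gqs L v)) [νQv.IsHaarMeasure] [νQv.IsMulRightInvariant] (mQv : OrbitalMeasureFamily (Gqs L v))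
    (hcanQ : mQv.IsCanonical (fun γ => IsRegularElt (γ.val : GL (Fin 3) (UnitaryGroup.LocalRing L v))) νQv)
    (μZ : Measure (Gqs L v ⧸ Subgroup.center (Gqs L v))) [μZ.IsHaarMeasure]
    (𝔇 : EllipticData (Gqs L v) H)
    (hC01 : 𝔇.μG = νQv) (hC03 : 𝔇.μGZ = μZ) (hC04 : 𝔇.orb = mQv)
    (hC05 : ∀ γ : Gqs L v, γ ∈ 𝔇.regG ↔ IsRegularElt (γ.val : GL (Fin 3) (UnitaryGroup.LocalRing L v)))
    (hE : ∀ γ : Gqs L v, γ ∈ 𝔇.ellG ↔ IsRegularElt (γ.val : GL (Fin 3) (UnitaryGroup.LocalRing L v)) ∧ γ ∉ hyperbolicSet L v)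
    (hchar : ∀ π : IrrClass (Gqs L v), Measurable (𝔇.char π) ∧ LocallyIntegrable (𝔇.char π) 𝔇.μG ∧
      (∀ x ∈ 𝔇.regG, ∀ᶠ y in 𝓝 x, 𝔇.char π y = 𝔇.char π x) ∧
      ∀ φ : Gqs L v → ℂ, IsLocSmooth φ → π.smoothTrace 𝔇.μG φ = ∫ x, φ x * 𝔇.char π x ∂𝔇.μG)
    (hAll : ∀ T : Subgroup (Gqs L v), T ∈ 𝔇.cartanAll ↔ T = (cmBorelTriple L 3 v).M ∨ T ∈ 𝔇.cartanG)
    (hHaar : (𝔇.μT (cmBorelTriple L 3 v).M).IsHaarMeasure)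
    (hcart : ∀ T ∈ 𝔇.cartanG, IsCompact (T : Set (Gqs L v)) ∧ ∃ γ₀ : Gqs L v, IsRegularElt (γ₀.val : GL (Fin 3) (UnitaryGroup.LocalRing L v)) ∧ T = Subgroup.centralizer ({γ₀} : Set (Gqs L v)))
    (hHaarG : ∀ T ∈ 𝔇.cartanG, (𝔇.μT T).IsHaarMeasure)
    (hfinG : ∀ T ∈ 𝔇.cartanG, IsFiniteMeasure (𝔇.μT T))
    (hker : ∀ T ∈ 𝔇.cartanG, ∃ s : Finset (Subgroup ↥T), (∀ K ∈ s, IsClosed (K : Set ↥T) ∧ ¬ IsOpen (K : Set ↥T)) ∧ ∀ t : ↥T, ¬ IsRegularElt ((t : Gqs L v).val : GL (Fin 3) (UnitaryGroup.LocalRing L v)) → ∃ K ∈ s, t ∈ K)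
    (eDG : ∀ g : Gqs L v, 𝔇.DG g = ((NNReal.sqrt (NNReal.sqrt ((∏ w : PlacesOver L v, IsNonarchimedeanLocalField.normAbs (w.1.adicCompletion L) (((g.val : GL (Fin 3) (UnitaryGroup.LocalRing L v)).val.charpoly.discr) w)) * ((∏ w : PlacesOver L v, IsNonarchimedeanLocalField.normAbs (w.1.adicCompletion L) (((g.val : GL (Fin 3) (UnitaryGroup.LocalRing L v)).val.det) w)) ^ 2)⁻¹)) : NNReal) : ℝ))
    (hcovA : ∀ γ : Gqs L v, IsRegularElt (γ.val : GL (Fin 3) (UnitaryGroup.LocalRing L v)) → ∃ T' ∈ 𝔇.cartanAll, ∃ x : Gqs L v, ∀ g : Gqs L v, g ∈ Subgroup.centralizer ({γ} : Set (Gqs L v)) ↔ x⁻¹ * g * x ∈ T')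
    (hncA : ∀ T' ∈ 𝔇.cartanAll, ∀ T'' ∈ 𝔇.cartanAll, T' ≠ T'' → ∀ y : Gqs L v, ¬ ∀ h : Gqs L v, h ∈ T'' ↔ y⁻¹ * h * y ∈ T')
    (hcptA : ∀ T' ∈ 𝔇.cartanAll, T' ≠ (cmBorelTriple L 3 v).M → IsCompact (T' : Set (Gqs L v)))
    (hinvT : ∀ T' ∈ 𝔇.cartanAll, (𝔇.μT T').IsInvInvariant)
    (hcoreT : ∀ T' ∈ 𝔇.cartanAll, 𝔇.μT T' (compactCore ↥T') = 1)
    -- Harish-Chandra's local boundedness of `|D_G|^{1∕2} χ_π` — NOT a pin of the socket (tier-0 stub 2 `stub_charLocBdd`)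
    (hHCB : normalizedCharacter_locallyBounded) :
    ∀ π π' : IrrClass (Gqs L v), 𝔇.IsL2 π → 𝔇.IsL2 π' → 𝔇.innerG (𝔇.char π) (𝔇.char π') = if π = π' then 1 else 0 := by
  obtain ⟨hWIF, hC1, hC2, hC3, hL2⟩ :=
    pctOutLetters_of_pins L v hns νQv mQv hcanQ 𝔇 hC01 hC04 hC05 hE hchar hAll hHaar hcart hHaarG hfinG hker eDG hcovA hncA hcptA hinvT hcoreT hHCB
  exact innerG_char_eq_ite_of_isL2_of_not_wild L v hns hv νQv mQv hcanQ 𝔇 hC01 hC04 hC05 hE hchar μZ hC03 hWIF hC1 hC2 hC3 hL2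

end Summit.HodgeConjecture.HodgeConjecture.Cruxes.H413.K2E3KazhdanL2OrthonormalNotWild

end
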